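import Literature.Probability.RandomPlanarGeometry.HypergeometricHalfODE
import Literature.Probability.RandomPlanarGeometry.SLEMomentSupersolution
import HarnessLib

/-!
# Rohde–Schramm's `Ĝ_{a,κ}` at the critical exponent `a = 1 - κ/8` is `(y/|z|)^{(8-κ)/κ}`

Topic `Probability/RandomPlanarGeometry`; real analysis. Rohde–Schramm, *Basic properties of SLE*,
Ann. of Math. 161 (2005), proof of Lemma 6.3, p. 905: "When `a = 1 - κ/8`, `Ĝ` simplifies to
`(y/|z|)^{(8-κ)/κ}`." In the tree `Ĝ_{a,κ}(w + i) = rsGhatSlope a κ w = ₂F₁(η₀, η₁, 1/2, w²/(1+w²))`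
(`HypergeometricHalfODE.lean`); we **prove**

  `rsGhatSlope (1 - κ/8) κ = rsPow ((8-κ)/(2κ))`,  i.e.  `Ĝ_{1-κ/8,κ}(w + i) = (1 + w²)^{-(8-κ)/(2κ)}`

(`rsGhatSlope_critical`, every `κ > 0`), hence `Ĝ_{1-κ/8,κ}(z) = (Im z)^{(8-κ)/κ}/|z|^{(8-κ)/κ} =
(sin arg z)^{8/κ-1}` — Beffara's angular factor in the one-point estimate
`P(B(z₀, ε) ∩ γ ≠ ∅) ≍ (ε/Im z₀)^{1-κ/8} (sin arg z₀)^{8/κ-1}` (Ann. Probab. 36 (2008), Prop. 4).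

Proof (Wronskian / uniqueness for the linear ODE (6.9)): both `h = rsGhatSlope (1-κ/8) κ` and
`φ = (1+w²)^{-β₀}`, `β₀ = (8-κ)/(2κ)`, solve `(κ/2) f'' + (4w/(1+w²)) f' + (4a₀/(1+w²)²) f = 0`
(`rsGhatSlope_ode`; `rsDriftOp_rsPow` with both coefficients `4a₀ - κβ₀`, `2κβ₀ + κ - 8` equal to
`0`), with `h(0) = φ(0) = 1`, `h'(0) = φ'(0) = 0`. The Wronskian `W = h'φ - hφ'` satisfies Abel's
identity `(W (1+w²)^{4/κ})' = 0`, so `W ≡ 0`, and then `(h (1+w²)^{β₀})' = W (1+w²)^{2β₀} = 0`, so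
`h (1+w²)^{β₀} ≡ 1`. Consequences for the stochastic layer: `0 < Ĝ_{a₀,κ} ≤ 1` along the slope and
`Ĝ_{a₀,κ}(s + i) → 0` as `s → ∞` for `κ < 8`.

This identifies the observable `ψₜ^{1-κ/8} Ĝ(zₜ)` of the tree's Itô step
(`martingale_stoppedProcess_sleRSObservable_of_le_locTime`, discriminant `32a₀κ + (2κ-8)² = 64`)
with the SLE Green's-function martingale `|gₜ'(z)|^{2-d} (Im gₜ)^{d-2} (sin arg (gₜ - Wₜ))^{8/κ-1}`,
`d = 1 + κ/8`.

## References

* S. Rohde, O. Schramm, *Basic properties of SLE*, Ann. of Math. 161 (2005), Lemma 6.3 and its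
  proof (pp. 903–906), eq. (6.9).
* V. Beffara, *The dimension of the SLE curves*, Ann. Probab. 36 (2008), Prop. 4.
-/

noncomputable section

open Set Real

namespace Literature.Probability.RandomPlanarGeometry

variable {κ : ℝ}

/-- The discriminant of Rohde–Schramm's `η₀, η₁` at `a = 1 - κ/8` is `64`. [folklore] -/
theorem discr_oneSub (κ : ℝ) : 32 * (1 - κ / 8) * κ + (2 * κ - 8) ^ 2 = 64 := by ring

/-- `rsGhatSlope a κ 0 = 1` (`Ĝ(i) = 1`, p. 904). [cite: RohdeSchramm2005, Lemma 6.3] -/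
theorem rsGhatSlope_zero (a κ : ℝ) : rsGhatSlope a κ 0 = 1 := by
  rw [rsGhatSlope, show slopeArg 0 = 0 by simp [slopeArg], ordinaryHypergeometric_zero]

/-- `(rsGhatSlope a κ)'(0) = 0` (the slope function is a function of `w²`). [folklore] -/
theorem deriv_rsGhatSlope_zero (a κ : ℝ) : deriv (rsGhatSlope a κ) 0 = 0 := by
  rw [deriv_rsGhatSlope]
  simp

/-- `rsPow β 0 = 1`. [folklore] -/
theorem rsPow_zero (β : ℝ) : rsPow β 0 = 1 := by simp [rsPow_apply]

/-- `(rsPow β)'(0) = 0`. [folklore] -/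
theorem deriv_rsPow_zero (β : ℝ) : deriv (rsPow β) 0 = 0 := by
  rw [deriv_rsPow]; simp

/-- **The critical power solves (6.9)**: for `κ ≠ 0`, `a₀ = 1 - κ/8`, `β₀ = (8-κ)/(2κ)` and
`φ = (1+w²)^{-β₀}`: `(κ/2) φ'' + (4w/(1+w²)) φ' + (4a₀/(1+w²)²) φ = 0` — both coefficients of
`rsDriftOp_rsPow` vanish (Rohde–Schramm's exact solution `(y/|z|)^{(8-κ)/κ}`, p. 905).
[cite: RohdeSchramm2005, Lemma 6.3 (proof, p. 905)] -/
theorem rsDriftOp_rsPow_critical (hκ : κ ≠ 0) (w : ℝ) :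
    rsDriftOp κ (1 - κ / 8) (rsPow ((8 - κ) / (2 * κ))) w = 0 := by
  rw [rsDriftOp_rsPow]
  have h1 : 4 * (1 - κ / 8) - κ * ((8 - κ) / (2 * κ)) = 0 := by field_simp; ring
  have h2 : 2 * κ * ((8 - κ) / (2 * κ)) + κ - 8 = 0 := by field_simp; ring
  rw [h1, h2]
  ring

/-- **`Ĝ_{1-κ/8,κ}(w + i) = (1 + w²)^{-(8-κ)/(2κ)}`** for every `κ > 0` and real `w`
(Rohde–Schramm (2005), p. 905: "When `a = 1 - κ/8`, `Ĝ` simplifies to `(y/|z|)^{(8-κ)/κ}`"), by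
uniqueness for the linear equation (6.9): the Wronskian of `rsGhatSlope (1-κ/8) κ` and the power
vanishes identically (Abel's identity), and both take the value `1` at `0`.
[cite: RohdeSchramm2005, Lemma 6.3 (proof, p. 905)] -/
theorem rsGhatSlope_critical (hκ : 0 < κ) (w : ℝ) :
    rsGhatSlope (1 - κ / 8) κ w = (1 + w ^ 2) ^ (-((8 - κ) / (2 * κ))) := by
  set a₀ : ℝ := 1 - κ / 8 with ha₀
  set β₀ : ℝ := (8 - κ) / (2 * κ) with hβ₀
  set h : ℝ → ℝ := rsGhatSlope a₀ κ with hh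
  set φ : ℝ → ℝ := rsPow β₀ with hφ
  have hκ0 : κ ≠ 0 := hκ.ne'
  have hdisc : 0 ≤ 32 * a₀ * κ + (2 * κ - 8) ^ 2 := by rw [ha₀, discr_oneSub]; norm_num
  have hu : ∀ w : ℝ, 0 < 1 + w ^ 2 := one_add_sq_pos'
  -- the two equations (6.9), solved for the second derivatives
  have hodeh : ∀ w, deriv (deriv h) w =
      -(2 / κ) * (4 * w / (1 + w ^ 2) * deriv h w + 4 * a₀ / (1 + w ^ 2) ^ 2 * h w) := by
    intro w
    have h0 := rsGhatSlope_ode hκ hdisc w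
    have h1 : κ / 2 * deriv (deriv h) w =
        -(4 * w / (1 + w ^ 2) * deriv h w + 4 * a₀ / (1 + w ^ 2) ^ 2 * h w) := by
      simp only [hh]; linarith
    calc deriv (deriv h) w = 2 / κ * (κ / 2 * deriv (deriv h) w) := by field_simp
      _ = _ := by rw [h1]; ring
  have hodeφ : ∀ w, deriv (deriv φ) w =
      -(2 / κ) * (4 * w / (1 + w ^ 2) * deriv φ w + 4 * a₀ / (1 + w ^ 2) ^ 2 * φ w) := by
    intro w
    have h0 := rsDriftOp_rsPow_critical hκ0 w
    rw [rsDriftOp, iteratedDeriv_succ, iteratedDeriv_one] at h0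
    rw [← ha₀, ← hβ₀, ← hφ] at h0
    have e1 : 4 * a₀ * φ w / (1 + w ^ 2) ^ 2 = 4 * a₀ / (1 + w ^ 2) ^ 2 * φ w := by ring
    have e2 : 4 * w * deriv φ w / (1 + w ^ 2) = 4 * w / (1 + w ^ 2) * deriv φ w := by ring
    rw [e1, e2] at h0
    have h1 : κ / 2 * deriv (deriv φ) w =
        -(4 * w / (1 + w ^ 2) * deriv φ w + 4 * a₀ / (1 + w ^ 2) ^ 2 * φ w) := by linarith
    calc deriv (deriv φ) w = 2 / κ * (κ / 2 * deriv (deriv φ) w) := by field_simp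
      _ = _ := by rw [h1]; ring
  -- values at `0`
  have hh0 : h 0 = 1 := by simp [hh, rsGhatSlope_zero]
  have hh'0 : deriv h 0 = 0 := by simp [hh, deriv_rsGhatSlope_zero]
  have hφ'0 : deriv φ 0 = 0 := by simp [hφ, deriv_rsPow_zero]
  -- closed forms of `φ`, `φ'`
  have hφw : ∀ w, φ w = (1 + w ^ 2) ^ (-β₀) := fun w ↦ by simp [hφ, rsPow_apply]
  have hφ'w : ∀ w, deriv φ w = -2 * β₀ * w * (1 + w ^ 2) ^ (-β₀ - 1) := fun w ↦ by
    simp [hφ, deriv_rsPow]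
  -- derivatives of `h` and `φ` as `HasDerivAt`
  have hh1 : ∀ w, HasDerivAt h (deriv h w) w := fun w ↦
    (hasDerivAt_rsGhatSlope a₀ κ w).differentiableAt.hasDerivAt
  have hh2 : ∀ w, HasDerivAt (deriv h) (deriv (deriv h) w) w := fun w ↦
    (hasDerivAt_deriv_rsGhatSlope a₀ κ w).differentiableAt.hasDerivAt
  have hφ1 : ∀ w, HasDerivAt φ (deriv φ w) w := fun w ↦
    (hasDerivAt_rsPow β₀ w).differentiableAt.hasDerivAt
  have hφ2 : ∀ w, HasDerivAt (deriv φ) (deriv (deriv φ) w) w := fun w ↦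
    (hasDerivAt_deriv_rsPow β₀ w).differentiableAt.hasDerivAt
  -- from here on the values of `a₀`, `β₀` are irrelevant except through the equations above
  clear_value a₀ β₀
  -- the Wronskian and Abel's identity
  set W : ℝ → ℝ := fun w ↦ deriv h w * φ w - h w * deriv φ w with hW
  have hW' : ∀ w, HasDerivAt W (-(8 * w / (κ * (1 + w ^ 2))) * W w) w := by
    intro w
    have hd : HasDerivAt W (deriv (deriv h) w * φ w + deriv h w * deriv φ w -
        (deriv h w * deriv φ w + h w * deriv (deriv φ) w)) w :=
      ((hh2 w).mul (hφ1 w)).sub ((hh1 w).mul (hφ2 w))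
    refine hd.congr_deriv ?_
    rw [hodeh w, hodeφ w]
    simp only [hW]
    have hP : (1 + w ^ 2) ≠ 0 := (hu w).ne'
    field_simp
    ring
  set V : ℝ → ℝ := fun w ↦ W w * (1 + w ^ 2) ^ (4 / κ) with hV
  have hV' : ∀ w, HasDerivAt V 0 w := by
    intro w
    have hp : HasDerivAt (fun w : ℝ ↦ (1 + w ^ 2) ^ (4 / κ))
        (2 * w * (4 / κ) * (1 + w ^ 2) ^ (4 / κ - 1)) w := by
      have hb : HasDerivAt (fun w : ℝ ↦ 1 + w ^ 2) (2 * w) w := by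
        simpa using (hasDerivAt_pow 2 w).const_add 1
      exact hb.rpow_const (p := 4 / κ) (Or.inl (hu w).ne')
    have hd := (hW' w).mul hp
    refine hd.congr_deriv ?_
    have hsplit : (1 + w ^ 2) ^ (4 / κ) = (1 + w ^ 2) * (1 + w ^ 2) ^ (4 / κ - 1) := by
      rw [show (4 / κ : ℝ) = 1 + (4 / κ - 1) by ring, rpow_add (hu w), rpow_one]
      ring_nf
    rw [hsplit]
    have hP : (1 + w ^ 2) ≠ 0 := (hu w).ne'
    field_simp
    ring
  have hVconst : ∀ w, V w = V 0 := fun w ↦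
    is_const_of_deriv_eq_zero (fun w ↦ (hV' w).differentiableAt) (fun w ↦ (hV' w).deriv) w 0
  have hV0 : V 0 = 0 := by
    simp only [hV, hW, hh'0, hφ'0]
    ring
  have hW0 : ∀ w, W w = 0 := by
    intro w
    have h1 : V w = 0 := (hVconst w).trans hV0
    have hpos : 0 < (1 + w ^ 2) ^ (4 / κ) := rpow_pos_of_pos (hu w) _
    simp only [hV] at h1
    exact (mul_eq_zero.1 h1).resolve_right hpos.ne'
  -- `W w = (h'(1+w²) + 2β₀ w h)(1+w²)^{-β₀-1}`, so the bracket vanishes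
  have hX : ∀ w, deriv h w * (1 + w ^ 2) + 2 * β₀ * w * h w = 0 := by
    intro w
    have hWw := hW0 w
    have hfac : W w = (deriv h w * (1 + w ^ 2) + 2 * β₀ * w * h w) * (1 + w ^ 2) ^ (-β₀ - 1) := by
      simp only [hW, hφw, hφ'w]
      rw [show -β₀ = (-β₀ - 1) + 1 by ring, rpow_add (hu w), rpow_one]
      ring
    rw [hfac] at hWw
    exact (mul_eq_zero.1 hWw).resolve_right (rpow_pos_of_pos (hu w) _).ne'
  -- `q = h (1+w²)^{β₀}` has derivative `0`
  set q : ℝ → ℝ := fun w ↦ h w * (1 + w ^ 2) ^ β₀ with hq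
  have hq' : ∀ w, HasDerivAt q 0 w := by
    intro w
    have hp : HasDerivAt (fun w : ℝ ↦ (1 + w ^ 2) ^ β₀) (2 * w * β₀ * (1 + w ^ 2) ^ (β₀ - 1)) w := by
      have hb : HasDerivAt (fun w : ℝ ↦ 1 + w ^ 2) (2 * w) w := by
        simpa using (hasDerivAt_pow 2 w).const_add 1
      exact hb.rpow_const (p := β₀) (Or.inl (hu w).ne')
    have hd := (hh1 w).mul hp
    refine hd.congr_deriv ?_
    have hm3 : (1 + w ^ 2) ^ β₀ = (1 + w ^ 2) * (1 + w ^ 2) ^ (β₀ - 1) := by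
      rw [show β₀ = 1 + (β₀ - 1) by ring, rpow_add (hu w), rpow_one]
      ring_nf
    calc deriv h w * (1 + w ^ 2) ^ β₀ + h w * (2 * w * β₀ * (1 + w ^ 2) ^ (β₀ - 1))
        = (deriv h w * (1 + w ^ 2) + 2 * β₀ * w * h w) * (1 + w ^ 2) ^ (β₀ - 1) := by
          rw [hm3]; ring
      _ = 0 := by rw [hX w, zero_mul]
  have hqconst : ∀ w, q w = q 0 := fun w ↦
    is_const_of_deriv_eq_zero (fun w ↦ (hq' w).differentiableAt) (fun w ↦ (hq' w).deriv) w 0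
  have hq0 : q 0 = 1 := by simp [hq, hh0]
  have hqw : h w * (1 + w ^ 2) ^ β₀ = 1 := (hqconst w).trans hq0
  calc rsGhatSlope a₀ κ w = h w := rfl
    _ = ((1 + w ^ 2) ^ β₀)⁻¹ := eq_inv_of_mul_eq_one_left hqw
    _ = (1 + w ^ 2) ^ (-β₀) := by rw [rpow_neg (hu w).le]

/-- The same as an identity of functions: `rsGhatSlope (1-κ/8) κ = rsPow ((8-κ)/(2κ))`.
[cite: RohdeSchramm2005, Lemma 6.3 (proof, p. 905)] -/
theorem rsGhatSlope_critical_eq_rsPow (hκ : 0 < κ) :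
    rsGhatSlope (1 - κ / 8) κ = rsPow ((8 - κ) / (2 * κ)) :=
  funext fun w ↦ by rw [rsGhatSlope_critical hκ, rsPow_apply]

/-- **`Ĝ_{1-κ/8,κ}(Z) = ((Im Z)²/(Re Z² + Im Z²))^{(8-κ)/(2κ)}`** for `Im Z ≠ 0`, `κ > 0`.
[cite: RohdeSchramm2005, Lemma 6.3 (proof, p. 905)] -/
theorem rsGhat_critical (hκ : 0 < κ) {Z : ℂ} (hZ : Z.im ≠ 0) :
    rsGhat (1 - κ / 8) κ Z = (Z.im ^ 2 / (Z.re ^ 2 + Z.im ^ 2)) ^ ((8 - κ) / (2 * κ)) := by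
  rw [rsGhat_eq_rsGhatSlope _ _ hZ, rsGhatSlope_critical hκ]
  have him : 0 < Z.im ^ 2 := by positivity
  have hden : 0 < Z.re ^ 2 + Z.im ^ 2 := by positivity
  have h1 : 1 + (Z.re / Z.im) ^ 2 = (Z.re ^ 2 + Z.im ^ 2) / Z.im ^ 2 := by
    field_simp
    ring
  rw [h1, rpow_neg (div_pos hden him).le, ← inv_rpow (div_pos hden him).le, inv_div]

/-- `0 < Ĝ_{1-κ/8,κ}(w + i) ≤ 1` for `κ > 0` with `κ ≤ 8`. [folklore] -/
theorem rsGhatSlope_critical_mem_Ioc (hκ : 0 < κ) (hκ8 : κ ≤ 8) (w : ℝ) :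
    rsGhatSlope (1 - κ / 8) κ w ∈ Ioc (0 : ℝ) 1 := by
  rw [rsGhatSlope_critical hκ, ← rsPow_apply]
  exact ⟨rsPow_pos _ w, rsPow_le_one (div_nonneg (by linarith) (by positivity)) w⟩

/-- `Ĝ_{1-κ/8,κ}(w + i)` is even and non-increasing in `|w|`: for `|v| ≤ s`,
`Ĝ(s + i) ≤ Ĝ(v + i)` (`κ > 0`, `κ ≤ 8`). [folklore] -/
theorem rsGhatSlope_critical_le_of_abs_le (hκ : 0 < κ) (hκ8 : κ ≤ 8) {v s : ℝ} (hvs : |v| ≤ s) :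
    rsGhatSlope (1 - κ / 8) κ s ≤ rsGhatSlope (1 - κ / 8) κ v := by
  rw [rsGhatSlope_critical hκ, rsGhatSlope_critical hκ]
  have hβ : 0 ≤ (8 - κ) / (2 * κ) := div_nonneg (by linarith) (by positivity)
  have hv2 : v ^ 2 ≤ s ^ 2 := by
    have := sq_abs v
    nlinarith [abs_nonneg v]
  exact rpow_le_rpow_of_nonpos (one_add_sq_pos' v) (by linarith) (neg_nonpos.2 hβ)

/-- `Ĝ_{1-κ/8,κ}(w + i) = Ĝ_{1-κ/8,κ}(|w| + i)`. [folklore] -/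
theorem rsGhatSlope_critical_abs (hκ : 0 < κ) (w : ℝ) :
    rsGhatSlope (1 - κ / 8) κ |w| = rsGhatSlope (1 - κ / 8) κ w := by
  rw [rsGhatSlope_critical hκ, rsGhatSlope_critical hκ, sq_abs]

/-- **`Ĝ_{1-κ/8,κ}(s + i) → 0` as `s → ∞`** for `0 < κ < 8`. [folklore] -/
theorem tendsto_rsGhatSlope_critical_atTop (hκ : 0 < κ) (hκ8 : κ < 8) :
    Filter.Tendsto (fun s ↦ rsGhatSlope (1 - κ / 8) κ s) Filter.atTop (nhds 0) := by
  have hβ : 0 < (8 - κ) / (2 * κ) := div_pos (by linarith) (by positivity)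
  have h1 : Filter.Tendsto (fun s : ℝ ↦ 1 + s ^ 2) Filter.atTop Filter.atTop :=
    Filter.tendsto_atTop_add_const_left _ _ (Filter.tendsto_pow_atTop two_ne_zero)
  have h2 := (tendsto_rpow_neg_atTop hβ).comp h1
  refine h2.congr fun s ↦ ?_
  simp only [Function.comp_apply]
  rw [rsGhatSlope_critical hκ]

end Literature.Probability.RandomPlanarGeometry
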